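import Literature.Algebra.EuclideanLattices.LatticePeriodicFunctions
import Literature.Algebra.EuclideanLattices.LatticePointCounting
import Mathlib.Topology.MetricSpace.ThickenedIndicator
import Mathlib.Analysis.Convex.Measure
import Mathlib.Analysis.SpecialFunctions.Pow.Asymptotics
import HarnessLib

/-!
# The summation lemma of Mitsui's generalized prime number theorem (cube boxes)

Topic `Literature/Algebra/EuclideanLattices`. The abstract real-analysis core of the count of the
totally positive prime (or integral) elements of a totally real number field in a homogeneously
expanding box (Mitsui 1956; Hecke 1920 §7): given

* a full lattice `L` in `E` (the logarithms of the totally positive units), a compact convex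
  `T ∋ 0` (the box in logarithmic coordinates) and `d > 0` (the degree);
* a family of finite multisets of points `y i ∈ E`, `i ∈ S m` (the "angles" of the ideals of norm
  `m` in a narrow class), **equidistributed with normalisation `x/(log x)^κ` and density `c`**:
  `(∑_{m ≤ x} ∑_{i ∈ S m} g(y_i)) (log x)^κ / x → c · mean g` for every continuous `L`-periodic `g`
  (`Equidistributed`);

the box count `Φ(X) = ∑_{m ≤ X} ∑_{i ∈ S m} F_{log(X/m)/d}(y_i)`, where
`F_s(y) = #{ℓ ∈ L : y + ℓ ∈ s T}` (`shapeFun`), satisfies: **for every `ε > 0` there are `lo ≤ hi`,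
`hi − lo ≤ ε`, depending only on `(L, T, d, ε)`, with `lo ≤ Φ(X) (log X)^κ/(c X) ≤ hi` for all large
`X`, for EVERY such family with `κ ≤ 1`** (`exists_sandwich`). Consequently two such families have
box counts with the same limit after normalisation (`tendsto_of_tendsto`), which is how the constant
of the prime count is read off from the integer count (no evaluation of the limit is needed).
The proof is the Riemann–Stieltjes sandwich: blocks in `s = log(X/m)/d`, monotonicity of `F_s` in
`s`, continuous periodic minorants/majorants of `F_s` from thickened indicators (null frontier of
convex sets), and an `e`-adic decomposition of the tail `s ≥ S₀` using `F_s ≤ C (1+s)^n`.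
Everything here is proved.

## References

* T. Mitsui, *Generalized prime number theorem*, Jap. J. Math. 26 (1956), 1–42, §3. [cite: Mitsui1956, §3]
* E. Hecke, *Eine neue Art von Zetafunktionen …* II, Math. Z. 6 (1920), 11–51, §7. [HeckeMathZ1920]
-/

noncomputable section

open MeasureTheory Module Submodule Filter Topology Finset ZSpan Metric Asymptotics
open Literature.Algebra.EuclideanLattices.LatticePeriodic

open scoped Real NNReal ENNReal Pointwise

namespace Literature.Algebra.EuclideanLattices.MitsuiSum

universe u

variable {E : Type*} [NormedAddCommGroup E] [NormedSpace ℝ E] [FiniteDimensional ℝ E]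
variable [MeasurableSpace E] [BorelSpace E]
variable (L : Submodule ℤ E) [DiscreteTopology L] [IsZLattice ℝ L]
variable (μ : Measure E) [μ.IsAddHaarMeasure]

/-! ## Equidistributed families and the box count -/

section Defs

/-- **An equidistributed family with normalisation `x/(log x)^κ` and density `c`**: for every
continuous `L`-periodic `g`, `(∑_{m ≤ x} ∑_{i ∈ S m} g(y_i)) (log x)^κ/x → c · mean g`.
[cite: Mitsui1956, §3] -/
def Equidistributed {ι : Type u} (S : ℕ → Finset ι) (y : ι → E) (κ : ℕ) (c : ℝ) : Prop :=
  ∀ g : E → ℝ, Continuous g → (∀ ℓ ∈ L, ∀ x, g (x + ℓ) = g x) →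
    Tendsto (fun x : ℝ ↦ (∑ m ∈ Icc 1 ⌊x⌋₊, ∑ i ∈ S m, g (y i)) * ((Real.log x) ^ κ / x))
      atTop (𝓝 (c * mean L μ g))

variable {L} in
/-- The shape function `F_S(y) = #{ℓ ∈ L : y + ℓ ∈ S}`, as the periodization of the indicator of `S`.
[cite: Mitsui1956, §3] -/
def shapeFun (S : Set E) : E → ℝ := periodize L (S.indicator fun _ ↦ (1 : ℝ))

/-- The box count `Φ(X) = ∑_{m ≤ X} ∑_{i ∈ S m} F_{(log(X/m)/d) T}(y_i)`. [cite: Mitsui1956, §3] -/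
def boxCount {ι : Type u} (T : Set E) (d : ℝ) (S : ℕ → Finset ι) (y : ι → E) (X : ℝ) : ℝ :=
  ∑ m ∈ Icc 1 ⌊X⌋₊, ∑ i ∈ S m, shapeFun (L := L) ((Real.log (X / m) / d) • T) (y i)

end Defs

/-! ## The shape function -/

section Shape

variable {L}

omit [NormedSpace ℝ E] [FiniteDimensional ℝ E] [MeasurableSpace E] [BorelSpace E] in
/-- A bounded set sits in a ball; the indicator vanishes outside. [folklore] -/
theorem indicator_eq_zero_of_norm {S : Set E} {R : ℝ} (hS : S ⊆ closedBall 0 R) (y : E) (hy : R < ‖y‖) :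
    S.indicator (fun _ ↦ (1 : ℝ)) y = 0 := by
  rw [Set.indicator_of_notMem]
  intro h
  have := hS h
  rw [mem_closedBall, dist_zero_right] at this
  linarith

omit [NormedSpace ℝ E] [FiniteDimensional ℝ E] [MeasurableSpace E] [BorelSpace E] [DiscreteTopology L]
  [IsZLattice ℝ L] in
/-- The shape function is nonnegative. [folklore] -/
theorem shapeFun_nonneg (S : Set E) (y : E) : 0 ≤ shapeFun (L := L) S y :=
  periodize_nonneg (fun _ ↦ Set.indicator_nonneg (fun _ _ ↦ zero_le_one) _) y

omit [MeasurableSpace E] [BorelSpace E] in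
/-- The shape function is monotone in the set (bounded sets). [folklore] -/
theorem shapeFun_mono {S S' : Set E} {R : ℝ} (hS' : S' ⊆ closedBall 0 R) (h : S ⊆ S') (y : E) :
    shapeFun (L := L) S y ≤ shapeFun (L := L) S' y :=
  periodize_mono (indicator_eq_zero_of_norm (h.trans hS')) (indicator_eq_zero_of_norm hS')
    (fun _ ↦ Set.indicator_le_indicator_of_subset h (fun _ ↦ zero_le_one) _) y

omit [NormedSpace ℝ E] [FiniteDimensional ℝ E] [MeasurableSpace E] [BorelSpace E] [DiscreteTopology L]
  [IsZLattice ℝ L] in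
/-- The shape function is `L`-periodic. [folklore] -/
theorem shapeFun_add_of_mem (S : Set E) {ℓ : E} (hℓ : ℓ ∈ L) (y : E) :
    shapeFun (L := L) S (y + ℓ) = shapeFun (L := L) S y :=
  periodize_add_of_mem _ hℓ y

omit [FiniteDimensional ℝ E] [MeasurableSpace E] [BorelSpace E] in
/-- Dilates of a convex set containing `0` increase. [folklore] -/
theorem smul_subset_smul {T : Set E} (hT : Convex ℝ T) (h0 : (0 : E) ∈ T) {s s' : ℝ} (hs : 0 ≤ s)
    (hss' : s ≤ s') : s • T ⊆ s' • T := by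
  rintro _ ⟨x, hx, rfl⟩
  rcases eq_or_lt_of_le (hs.trans hss') with h | h
  · have : s = 0 := le_antisymm (h ▸ hss') hs
    subst this
    rw [← h]
    exact Set.smul_mem_smul_set hx
  · refine ⟨(s / s') • x, hT.smul_mem_of_zero_mem h0 hx ⟨div_nonneg hs h.le, div_le_one_of_le₀ hss' h.le⟩, ?_⟩
    show s' • ((s / s') • x) = s • x
    rw [smul_smul, mul_div_cancel₀ _ h.ne']

omit [FiniteDimensional ℝ E] [MeasurableSpace E] [BorelSpace E] in
/-- A dilate of a bounded set is bounded by the dilated radius. [folklore] -/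
theorem smul_subset_closedBall {T : Set E} {R : ℝ} (hT : T ⊆ closedBall 0 R) {s : ℝ} (hs : 0 ≤ s) :
    s • T ⊆ closedBall 0 (s * R) := by
  rintro _ ⟨x, hx, rfl⟩
  have := hT hx
  rw [mem_closedBall, dist_zero_right] at this ⊢
  rw [norm_smul, Real.norm_of_nonneg hs]
  exact mul_le_mul_of_nonneg_left this hs

omit [MeasurableSpace E] [BorelSpace E] in
/-- Monotonicity of `F_{sT}` in `s`. [folklore] -/
theorem shapeFun_smul_mono {T : Set E} (hT : Convex ℝ T) (h0 : (0 : E) ∈ T) {R : ℝ} (hR : T ⊆ closedBall 0 R)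
    {s s' : ℝ} (hs : 0 ≤ s) (hss' : s ≤ s') (y : E) :
    shapeFun (L := L) (s • T) y ≤ shapeFun (L := L) (s' • T) y :=
  shapeFun_mono (smul_subset_closedBall hR (hs.trans hss')) (smul_subset_smul hT h0 hs hss') y

/-- The number of lattice points of norm `≤ ρ` is `O((ρ + B)^n)`. [folklore] -/
theorem exists_card_ballPts_le (μ : Measure E) [μ.IsAddHaarMeasure] :
    ∃ A B : ℝ, 0 ≤ A ∧ 0 ≤ B ∧ ∀ ρ : ℝ, 0 ≤ ρ →
      ((ballPts (L := L) ρ).card : ℝ) ≤ A * (ρ + B) ^ finrank ℝ E := by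
  refine ⟨μ.real (closedBall (0 : E) 1) / μ.real (fundamentalDomain (rBasis L)), 2 * cellRadius (rBasis L),
    div_nonneg measureReal_nonneg measureReal_nonneg,
    mul_nonneg zero_le_two (cellRadius_nonneg _), fun ρ hρ ↦ ?_⟩
  classical
  set T : Finset E := (ballPts (L := L) ρ).map ⟨((↑) : L → E), Subtype.val_injective⟩ with hTdef
  have hT : ∀ ℓ ∈ T, ℓ ∈ span ℤ (Set.range (rBasis L)) := by
    intro ℓ hℓ
    rw [rBasis_span]
    obtain ⟨ℓ', _, rfl⟩ := Finset.mem_map.1 hℓ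
    exact ℓ'.2
  have hcard : (ballPts (L := L) ρ).card = T.card := by rw [hTdef, Finset.card_map]
  have h := card_le_of_cell_inter_closedBall (rBasis L) μ hT (y := 0) (r := ρ) fun ℓ hℓ ↦ by
    obtain ⟨ℓ', hℓ', rfl⟩ := Finset.mem_map.1 hℓ
    refine ⟨ℓ', self_mem_cell _ (by rw [rBasis_span]; exact ℓ'.2), ?_⟩
    rw [mem_closedBall, dist_zero_right]
    exact mem_ballPts.1 hℓ'
  rw [hcard]
  refine h.trans (le_of_eq ?_)
  have hρB : 0 ≤ ρ + 2 * cellRadius (rBasis L) := add_nonneg hρ (mul_nonneg zero_le_two (cellRadius_nonneg _))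
  rw [measureReal_def, Measure.addHaar_closedBall' μ (0 : E) hρB, ENNReal.toReal_mul,
    ENNReal.toReal_ofReal (pow_nonneg hρB _), ← measureReal_def]
  ring

/-- **`F_{sT}(y) ≤ C (1 + s)^n`** uniformly in `y`. [cite: Mitsui1956, §3] -/
theorem exists_shapeFun_le (μ : Measure E) [μ.IsAddHaarMeasure] {T : Set E} {R : ℝ}
    (hR : T ⊆ closedBall 0 R) (hR0 : 0 ≤ R) :
    ∃ C : ℝ, 0 ≤ C ∧ ∀ s : ℝ, 0 ≤ s → ∀ y : E, shapeFun (L := L) (s • T) y ≤ C * (1 + s) ^ finrank ℝ E := by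
  obtain ⟨A, B, hA, hB, hAB⟩ := exists_card_ballPts_le (L := L) μ
  obtain ⟨RD, hRD⟩ := isBounded_iff_forall_norm_le.1 (fdom_isBounded L)
  have hRD0 : 0 ≤ RD := by
    have h0 : (0 : E) ∈ fdom L := by
      rw [fdom, mem_fundamentalDomain]; intro i; simp
    simpa using hRD 0 h0
  set M : ℝ := max R (RD + B) with hM
  have hM0 : 0 ≤ M := le_max_of_le_left hR0
  refine ⟨A * M ^ finrank ℝ E, mul_nonneg hA (pow_nonneg hM0 _), fun s hs y ↦ ?_⟩
  -- reduce to `y ∈ fdom`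
  set y' : E := fract (rBasis L) y with hy'
  have hyy' : y = y' + (y - y') := by abel
  have hmem : y - y' ∈ L := by
    rw [hy', fract_apply, sub_sub_cancel]
    have h : ∀ z : E, z ∈ span ℤ (Set.range (rBasis L)) → z ∈ L := fun z hz ↦ by rwa [rBasis_span L] at hz
    exact h _ (floor (rBasis L) y).2
  rw [hyy', shapeFun_add_of_mem _ hmem]
  have hy'D : ‖y'‖ ≤ RD := hRD y' (fract_mem_fundamentalDomain _ _)
  -- a finite sum of at most `#ballPts (sR + RD)` ones
  have hvan := indicator_eq_zero_of_norm (smul_subset_closedBall hR hs)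
  rw [shapeFun, periodize_eq_sum hvan hy'D]
  calc (∑ ℓ ∈ ballPts (L := L) (s * R + RD), (s • T).indicator (fun _ ↦ (1 : ℝ)) (y' + ℓ))
      ≤ ∑ ℓ ∈ ballPts (L := L) (s * R + RD), (1 : ℝ) :=
        Finset.sum_le_sum fun ℓ _ ↦ Set.indicator_le_self' (fun _ _ ↦ zero_le_one) _
    _ = (ballPts (L := L) (s * R + RD)).card := by rw [Finset.sum_const, nsmul_eq_mul, mul_one]
    _ ≤ A * (s * R + RD + B) ^ finrank ℝ E := hAB _ (by positivity)
    _ ≤ A * (M * (1 + s)) ^ finrank ℝ E := by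
        refine mul_le_mul_of_nonneg_left (pow_le_pow_left₀ (by positivity) ?_ _) hA
        have h1 : s * R ≤ s * M := mul_le_mul_of_nonneg_left (le_max_left _ _) hs
        have h2 : RD + B ≤ M := le_max_right _ _
        nlinarith
    _ = A * M ^ finrank ℝ E * (1 + s) ^ finrank ℝ E := by rw [mul_pow]; ring

end Shape

/-! ## Continuous minorants and majorants of an indicator -/

section Thicken

/-- **Majorant**: for compact `S` and `η > 0` there is a continuous `h ≥ 1_S`, `0 ≤ h ≤ 1`, vanishing
outside the `1`-thickening of `S`, with `∫ h ≤ μ(S) + η`. [folklore] -/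
theorem exists_majorant {S : Set E} (hS : IsCompact S) {η : ℝ} (hη : 0 < η) :
    ∃ h : E → ℝ, Continuous h ∧ (∀ x, S.indicator (fun _ ↦ (1 : ℝ)) x ≤ h x) ∧ (∀ x, 0 ≤ h x) ∧ (∀ x, h x ≤ 1) ∧
      (∀ x, x ∉ cthickening 1 S → h x = 0) ∧ ∫ x, h x ∂μ ≤ μ.real S + η := by
  -- a small closed thickening has measure `≤ μ S + η`
  have ht := tendsto_measure_cthickening_of_isCompact (μ := μ) hS
  have hSfin : μ S < ⊤ := hS.measure_lt_top
  have hlt : μ S < μ S + ENNReal.ofReal η := ENNReal.lt_add_right hSfin.ne (by simpa using hη)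
  have hev := (tendsto_order.1 ht).2 _ hlt
  obtain ⟨e, he, hball⟩ := Metric.eventually_nhds_iff.1 hev
  set δ : ℝ := min (e / 2) 1 with hδ
  have hδ0 : 0 < δ := lt_min (half_pos he) one_pos
  have hδ1 : δ ≤ 1 := min_le_right _ _
  have hδe : μ (cthickening δ S) < μ S + ENNReal.ofReal η := hball (by
    rw [Real.dist_eq, sub_zero, abs_of_pos hδ0]; exact (min_le_left _ _).trans_lt (half_lt_self he))
  refine ⟨fun x ↦ (thickenedIndicator hδ0 S x : ℝ), NNReal.continuous_coe.comp (thickenedIndicator hδ0 S).continuous,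
    fun x ↦ ?_, fun x ↦ (thickenedIndicator hδ0 S x).2, fun x ↦ ?_, fun x hx ↦ ?_, ?_⟩
  · dsimp only
    by_cases hx : x ∈ S
    · rw [Set.indicator_of_mem hx, thickenedIndicator_one hδ0 S hx]; simp
    · rw [Set.indicator_of_notMem hx]; exact (thickenedIndicator hδ0 S x).2
  · exact_mod_cast thickenedIndicator_le_one hδ0 S x
  · dsimp only
    have : x ∉ thickening δ S := fun h ↦ hx (cthickening_mono hδ1 S (thickening_subset_cthickening δ S h))
    rw [thickenedIndicator_zero hδ0 S this]; simp
  · -- `∫ h ≤ μ (cthickening δ S) ≤ μ S + η`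
    have hcpt : IsCompact (cthickening δ S) := hS.cthickening
    have hle : ∀ x, (thickenedIndicator hδ0 S x : ℝ) ≤ (cthickening δ S).indicator (fun _ ↦ (1 : ℝ)) x := by
      intro x
      by_cases hx : x ∈ cthickening δ S
      · rw [Set.indicator_of_mem hx]; exact_mod_cast thickenedIndicator_le_one hδ0 S x
      · rw [Set.indicator_of_notMem hx]
        have : x ∉ thickening δ S := fun h ↦ hx (thickening_subset_cthickening δ S h)
        rw [thickenedIndicator_zero hδ0 S this]; simp
    have hint1 : Integrable (fun x ↦ (thickenedIndicator hδ0 S x : ℝ)) μ := by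
      refine Continuous.integrable_of_hasCompactSupport
        (NNReal.continuous_coe.comp (thickenedIndicator hδ0 S).continuous) ?_
      refine HasCompactSupport.of_support_subset_isCompact hcpt fun x hx ↦ ?_
      by_contra h'
      have : x ∉ thickening δ S := fun h ↦ h' (thickening_subset_cthickening δ S h)
      exact hx (by dsimp only; rw [thickenedIndicator_zero hδ0 S this]; simp)
    have hint2 : Integrable ((cthickening δ S).indicator fun _ ↦ (1 : ℝ)) μ :=
      (integrable_indicator_iff isClosed_cthickening.measurableSet).2
        (integrableOn_const hcpt.measure_lt_top.ne)
    calc ∫ x, (thickenedIndicator hδ0 S x : ℝ) ∂μ ≤ ∫ x, (cthickening δ S).indicator (fun _ ↦ (1 : ℝ)) x ∂μ :=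
          integral_mono hint1 hint2 hle
      _ = μ.real (cthickening δ S) := by
          rw [integral_indicator isClosed_cthickening.measurableSet, setIntegral_const, smul_eq_mul, mul_one]
      _ ≤ μ.real S + η := by
          rw [measureReal_def, measureReal_def, ← ENNReal.toReal_ofReal hη.le, ← ENNReal.toReal_add hSfin.ne
            ENNReal.ofReal_ne_top]
          exact ENNReal.toReal_mono (ENNReal.add_ne_top.2 ⟨hSfin.ne, ENNReal.ofReal_ne_top⟩) hδe.le

omit [NormedSpace ℝ E] [FiniteDimensional ℝ E] in
/-- **Minorant**: for compact `S` with null frontier and `η > 0` there is a continuous `h`,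
`0 ≤ h ≤ 1_S`, with `∫ h ≥ μ(S) − η`. [folklore] -/
theorem exists_minorant {S : Set E} (hS : IsCompact S) (hfr : μ (frontier S) = 0) {η : ℝ} (hη : 0 < η) :
    ∃ h : E → ℝ, Continuous h ∧ (∀ x, h x ≤ S.indicator (fun _ ↦ (1 : ℝ)) x) ∧ (∀ x, 0 ≤ h x) ∧
      μ.real S - η ≤ ∫ x, h x ∂μ := by
  have hSfin : μ S < ⊤ := hS.measure_lt_top
  have hSm : MeasurableSet S := hS.isClosed.measurableSet
  -- the sets `A r = S ∩ cthickening r Sᶜ` decrease to `S ∩ closure Sᶜ ⊆ frontier S`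
  set A : ℝ → Set E := fun r ↦ S ∩ cthickening r Sᶜ with hA
  have hlim : Tendsto (μ ∘ A) (𝓝[>] 0) (𝓝 (μ (⋂ r > (0 : ℝ), A r))) :=
    tendsto_measure_biInter_gt (fun r _ ↦ (hSm.inter isClosed_cthickening.measurableSet).nullMeasurableSet)
      (fun i j _ hij ↦ Set.inter_subset_inter_right _ (cthickening_mono hij _))
      ⟨1, one_pos, (measure_mono Set.inter_subset_left).trans_lt hSfin |>.ne⟩
  have hzero : μ (⋂ r > (0 : ℝ), A r) = 0 := by
    have hsub : (⋂ r > (0 : ℝ), A r) ⊆ frontier S := by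
      intro x hx
      simp only [hA, Set.mem_iInter, Set.mem_inter_iff] at hx
      have hxS : x ∈ S := (hx 1 one_pos).1
      have hxc : x ∈ closure Sᶜ := by
        rw [closure_eq_iInter_cthickening]
        simp only [Set.mem_iInter]
        exact fun r hr ↦ (hx r hr).2
      rw [hS.isClosed.frontier_eq, Set.mem_sdiff]
      refine ⟨hxS, fun hi ↦ ?_⟩
      rw [closure_compl, Set.mem_compl_iff] at hxc
      exact hxc hi
    exact measure_mono_null hsub hfr
  rw [hzero] at hlim
  have hlt : (0 : ℝ≥0∞) < ENNReal.ofReal η := by simpa using hη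
  have hev := (tendsto_order.1 hlim).2 _ hlt
  obtain ⟨δ, hδmem, hδ⟩ := (hev.and self_mem_nhdsWithin).exists
  have hδ0 : 0 < δ := hδ
  have hAδ : μ (A δ) < ENNReal.ofReal η := hδmem
  -- the minorant `1 - thickenedIndicator δ Sᶜ`
  refine ⟨fun x ↦ 1 - (thickenedIndicator hδ0 Sᶜ x : ℝ),
    continuous_const.sub (NNReal.continuous_coe.comp (thickenedIndicator hδ0 Sᶜ).continuous),
    fun x ↦ ?_, fun x ↦ ?_, ?_⟩
  · dsimp only
    by_cases hx : x ∈ S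
    · rw [Set.indicator_of_mem hx]
      have : (0 : ℝ) ≤ (thickenedIndicator hδ0 Sᶜ x : ℝ) := NNReal.coe_nonneg _
      linarith
    · rw [Set.indicator_of_notMem hx, thickenedIndicator_one hδ0 Sᶜ hx]; simp
  · dsimp only
    have : (thickenedIndicator hδ0 Sᶜ x : ℝ) ≤ 1 := by exact_mod_cast thickenedIndicator_le_one hδ0 Sᶜ x
    linarith
  · -- `∫ h ≥ μ (S \ thickening δ Sᶜ) ≥ μ S - μ (A δ)`
    set B : Set E := S \ thickening δ Sᶜ with hB
    have hBm : MeasurableSet B := hSm.diff isOpen_thickening.measurableSet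
    have hle : ∀ x, B.indicator (fun _ ↦ (1 : ℝ)) x ≤ 1 - (thickenedIndicator hδ0 Sᶜ x : ℝ) := by
      intro x
      by_cases hx : x ∈ B
      · rw [Set.indicator_of_mem hx, thickenedIndicator_zero hδ0 Sᶜ hx.2]; simp
      · rw [Set.indicator_of_notMem hx]
        have : (thickenedIndicator hδ0 Sᶜ x : ℝ) ≤ 1 := by exact_mod_cast thickenedIndicator_le_one hδ0 Sᶜ x
        linarith
    have hsupp : ∀ x, x ∉ S → 1 - (thickenedIndicator hδ0 Sᶜ x : ℝ) = 0 := fun x hx ↦ by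
      rw [thickenedIndicator_one hδ0 Sᶜ hx]; simp
    have hint1 : Integrable (fun x ↦ 1 - (thickenedIndicator hδ0 Sᶜ x : ℝ)) μ := by
      refine Continuous.integrable_of_hasCompactSupport
        (continuous_const.sub (NNReal.continuous_coe.comp (thickenedIndicator hδ0 Sᶜ).continuous)) ?_
      exact HasCompactSupport.of_support_subset_isCompact hS fun x hx ↦ by
        by_contra h'; exact hx (hsupp x h')
    have hint2 : Integrable (B.indicator fun _ ↦ (1 : ℝ)) μ :=
      (integrable_indicator_iff hBm).2 (integrableOn_const ((measure_mono Set.sdiff_subset).trans_lt hSfin).ne)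
    have h1 : μ.real B = ∫ x, B.indicator (fun _ ↦ (1 : ℝ)) x ∂μ := by
      rw [integral_indicator hBm, setIntegral_const, smul_eq_mul, mul_one]
    have h2 : μ.real S ≤ μ.real B + μ.real (A δ) := by
      have hsub : S ⊆ B ∪ A δ := by
        intro x hx
        by_cases h : x ∈ thickening δ Sᶜ
        · exact Or.inr ⟨hx, thickening_subset_cthickening _ _ h⟩
        · exact Or.inl ⟨hx, h⟩
      calc μ.real S ≤ μ.real (B ∪ A δ) := measureReal_mono hsub (by
            exact ((measure_mono Set.sdiff_subset).trans_lt hSfin |> fun h ↦ (measure_union_le _ _).trans_lt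
              (ENNReal.add_lt_top.2 ⟨h, (measure_mono Set.inter_subset_left).trans_lt hSfin⟩)).ne)
        _ ≤ μ.real B + μ.real (A δ) := measureReal_union_le _ _
    have h3 : μ.real (A δ) ≤ η := by
      rw [measureReal_def, ← ENNReal.toReal_ofReal hη.le]
      exact ENNReal.toReal_mono ENNReal.ofReal_ne_top hAδ.le
    calc μ.real S - η ≤ μ.real B := by linarith
      _ = ∫ x, B.indicator (fun _ ↦ (1 : ℝ)) x ∂μ := h1
      _ ≤ ∫ x, (1 - (thickenedIndicator hδ0 Sᶜ x : ℝ)) ∂μ := integral_mono hint2 hint1 hle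

end Thicken

/-! ## Blocks in `s = log(X/m)/d` -/

section Blocks

/-- Telescoping a sum over `m ≤ x₀` along a decreasing sequence `x₀ ≥ x₁ ≥ ⋯ ≥ x_K`. [folklore] -/
theorem sum_Icc_telescope (a : ℕ → ℝ) {x : ℕ → ℝ} (hx : Antitone x) (K : ℕ) :
    ∑ m ∈ Icc 1 ⌊x 0⌋₊, a m =
      (∑ k ∈ Finset.range K, ∑ m ∈ Icc 1 ⌊x k⌋₊ \ Icc 1 ⌊x (k + 1)⌋₊, a m) + ∑ m ∈ Icc 1 ⌊x K⌋₊, a m := by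
  induction K with
  | zero => simp
  | succ K ih =>
    have hsub : Icc 1 ⌊x (K + 1)⌋₊ ⊆ Icc 1 ⌊x K⌋₊ :=
      Icc_subset_Icc le_rfl (Nat.floor_mono (hx K.le_succ))
    rw [Finset.sum_range_succ, ih, add_assoc, ← Finset.sum_sdiff hsub]

/-- Membership in a block. [folklore] -/
theorem mem_block {t t' X : ℝ} (ht : 0 ≤ t) (ht' : 0 ≤ t') (hX : 0 ≤ X) {m : ℕ}
    (hm : m ∈ Icc 1 ⌊t * X⌋₊ \ Icc 1 ⌊t' * X⌋₊) : t' * X < m ∧ (m : ℝ) ≤ t * X ∧ 1 ≤ m := by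
  rw [Finset.mem_sdiff, Finset.mem_Icc, Finset.mem_Icc, not_and, not_le] at hm
  obtain ⟨⟨h1, h2⟩, h3⟩ := hm
  exact ⟨(Nat.floor_lt (mul_nonneg ht' hX)).1 (h3 h1), (Nat.le_floor_iff (mul_nonneg ht hX)).1 h2, h1⟩

/-- Lower bound for `s = log(X/m)/d` on a block. [folklore] -/
theorem le_log_div {d σ X : ℝ} (hd : 0 < d) {m : ℕ} (hm1 : 1 ≤ m) (hm : (m : ℝ) ≤ Real.exp (-(d * σ)) * X) :
    σ ≤ Real.log (X / m) / d := by
  have hm0 : (0 : ℝ) < m := by exact_mod_cast hm1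
  rw [le_div_iff₀ hd]
  have hXm : Real.exp (d * σ) ≤ X / m := by
    rw [le_div_iff₀ hm0]
    have h := mul_le_mul_of_nonneg_left hm (Real.exp_pos (d * σ)).le
    rwa [← mul_assoc, ← Real.exp_add, add_neg_cancel, Real.exp_zero, one_mul] at h
  have hpos : 0 < X / m := (Real.exp_pos _).trans_le hXm
  rw [mul_comm, Real.le_log_iff_exp_le hpos]
  exact hXm

/-- Upper bound for `s = log(X/m)/d` on a block. [folklore] -/
theorem log_div_lt {d σ X : ℝ} (hd : 0 < d) (hX : 0 < X) {m : ℕ} (hm1 : 1 ≤ m) (hm : Real.exp (-(d * σ)) * X < m) :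
    Real.log (X / m) / d < σ := by
  have hm0 : (0 : ℝ) < m := by exact_mod_cast hm1
  rw [div_lt_iff₀ hd]
  have hXm : X / m < Real.exp (d * σ) := by
    rw [div_lt_iff₀ hm0]
    have h := mul_lt_mul_of_pos_left hm (Real.exp_pos (d * σ))
    rwa [← mul_assoc, ← Real.exp_add, add_neg_cancel, Real.exp_zero, one_mul] at h
  rw [mul_comm, Real.log_lt_iff_lt_exp (div_pos hX hm0)]
  exact hXm

/-- `s = log(X/m)/d ≥ 0` for `1 ≤ m ≤ X`. [folklore] -/
theorem log_div_nonneg {d X : ℝ} (hd : 0 < d) {m : ℕ} (hm1 : 1 ≤ m) (hm : (m : ℝ) ≤ X) :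
    0 ≤ Real.log (X / m) / d := by
  have h := le_log_div (σ := 0) hd hm1 (by simpa using hm)
  exact h

variable {L μ}

omit [BorelSpace E] [μ.IsAddHaarMeasure] in
/-- **Block sums of an equidistributed family**: `(∑_{m ≤ tX} ∑_i g(y_i)) (log X)^κ/X → t c mean g`.
[folklore] -/
theorem tendsto_blockSum {ι : Type u} {S : ℕ → Finset ι} {y : ι → E} {κ : ℕ} {c : ℝ}
    (hE : Equidistributed L μ S y κ c) {g : E → ℝ} (hg : Continuous g) (hper : ∀ ℓ ∈ L, ∀ x, g (x + ℓ) = g x)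
    {t : ℝ} (ht : 0 < t) :
    Tendsto (fun X : ℝ ↦ (∑ m ∈ Icc 1 ⌊t * X⌋₊, ∑ i ∈ S m, g (y i)) * ((Real.log X) ^ κ / X)) atTop
      (𝓝 (t * (c * mean L μ g))) := by
  have h1 := (hE g hg hper).comp (tendsto_id.const_mul_atTop ht)
  -- the ratio of logarithms tends to `1`
  have hratio : Tendsto (fun X : ℝ ↦ Real.log X / Real.log (t * X)) atTop (𝓝 1) := by
    have h0 : Tendsto (fun X : ℝ ↦ Real.log t / (Real.log t + Real.log X)) atTop (𝓝 0) :=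
      tendsto_const_nhds.div_atTop (tendsto_atTop_add_const_left atTop (Real.log t) Real.tendsto_log_atTop)
    have h2 : Tendsto (fun X : ℝ ↦ 1 - Real.log t / (Real.log t + Real.log X)) atTop (𝓝 (1 - 0)) :=
      tendsto_const_nhds.sub h0
    rw [sub_zero] at h2
    refine h2.congr' ?_
    filter_upwards [eventually_gt_atTop (0 : ℝ),
      Real.tendsto_log_atTop.eventually_gt_atTop (-Real.log t)] with X hX hlog
    have hne : Real.log t + Real.log X ≠ 0 := by linarith
    rw [Real.log_mul ht.ne' hX.ne']
    field_simp
    ring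
  have h2 : Tendsto (fun X : ℝ ↦ t * (Real.log X / Real.log (t * X)) ^ κ) atTop (𝓝 (t * 1 ^ κ)) :=
    tendsto_const_nhds.mul (hratio.pow κ)
  rw [one_pow, mul_one] at h2
  have h3 := h1.mul h2
  rw [mul_comm (c * mean L μ g) t] at h3
  refine h3.congr' ?_
  filter_upwards [eventually_gt_atTop (0 : ℝ), eventually_gt_atTop t⁻¹,
    Real.tendsto_log_atTop.eventually_gt_atTop (-Real.log t)] with X hX0 hXt hlog
  have htX : Real.log (t * X) ≠ 0 := by
    rw [Real.log_mul ht.ne' hX0.ne']; linarith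
  simp only [Function.comp_apply, id]
  field_simp
  rw [div_pow]
  field_simp

/-- **A priori count**: an equidistributed family has `N(x) = ∑_{m ≤ x} #S m ≤ 2c x/(log x)^κ` for
large `x`. [folklore] -/
theorem eventually_count_le {ι : Type u} {S : ℕ → Finset ι} {y : ι → E} {κ : ℕ} {c : ℝ}
    (hE : Equidistributed L μ S y κ c) (hc : 0 < c) :
    ∀ᶠ x : ℝ in atTop, (∑ m ∈ Icc 1 ⌊x⌋₊, ((S m).card : ℝ)) ≤ 2 * c * x / (Real.log x) ^ κ := by
  have h := hE (fun _ ↦ 1) continuous_const (fun _ _ _ ↦ rfl)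
  rw [mean_const] at h
  simp only [Finset.sum_const, nsmul_eq_mul, mul_one] at h
  have hev := (Metric.tendsto_nhds.1 h) c hc
  filter_upwards [hev, eventually_gt_atTop (1 : ℝ)] with x hx hx1
  rw [Real.dist_eq, abs_lt] at hx
  have hlog : 0 < Real.log x := Real.log_pos hx1
  have hw : 0 < (Real.log x) ^ κ / x := div_pos (pow_pos hlog _) (by linarith)
  have h2 : (∑ m ∈ Icc 1 ⌊x⌋₊, ((S m).card : ℝ)) * ((Real.log x) ^ κ / x) ≤ 2 * c := by linarith [hx.2]
  rw [le_div_iff₀ (pow_pos hlog _)]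
  have := (le_div_iff₀ hw).2 h2
  calc (∑ m ∈ Icc 1 ⌊x⌋₊, ((S m).card : ℝ)) * (Real.log x) ^ κ
      = (∑ m ∈ Icc 1 ⌊x⌋₊, ((S m).card : ℝ)) * ((Real.log x) ^ κ / x) * x := by field_simp
    _ ≤ 2 * c * x := by nlinarith [h2]

/-- The count is monotone. [folklore] -/
theorem count_mono {ι : Type u} (S : ℕ → Finset ι) {u u' : ℝ} (h : u ≤ u') :
    (∑ m ∈ Icc 1 ⌊u⌋₊, ((S m).card : ℝ)) ≤ ∑ m ∈ Icc 1 ⌊u'⌋₊, ((S m).card : ℝ) :=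
  Finset.sum_le_sum_of_subset_of_nonneg (Icc_subset_Icc le_rfl (Nat.floor_mono h)) fun _ _ _ ↦ Nat.cast_nonneg _

/-- Low blocks are negligible: a polylogarithmic quantity times `√X` is eventually `≤ θ X`. [folklore] -/
theorem eventually_polylog_sqrt_le {C d : ℝ} (hC : 0 ≤ C) (hd : 0 < d) (S₀ n κ : ℕ) (hκ : κ ≤ 1) {θ : ℝ}
    (hθ : 0 < θ) :
    ∀ᶠ X : ℝ in atTop, 2 * C * ((⌊Real.log X / d⌋₊ : ℝ) + 1) * (2 + S₀ + ((⌊Real.log X / d⌋₊ : ℝ) + 1)) ^ n *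
      Real.sqrt X * (Real.log X) ^ κ ≤ θ * X := by
  set M : ℝ := 2 * C * (1 / d + 1) * (3 + S₀ + 1 / d) ^ n with hM
  have hM0 : 0 ≤ M := by positivity
  have hlo := (isLittleO_log_rpow_rpow_atTop ((n + 2 : ℕ) : ℝ) (by norm_num : (0 : ℝ) < 1 / 2)).def
    (div_pos hθ (by linarith : (0 : ℝ) < M + 1))
  filter_upwards [hlo, eventually_ge_atTop (Real.exp 1)] with X hX hXe
  have hX1 : 1 ≤ X := le_trans (by have := Real.add_one_le_exp (1 : ℝ); linarith) hXe
  have hlog1 : 1 ≤ Real.log X := by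
    rw [Real.le_log_iff_exp_le (by linarith)]; exact hXe
  have hlog0 : 0 ≤ Real.log X := zero_le_one.trans hlog1
  -- unpack the little-o bound
  rw [Real.norm_of_nonneg (Real.rpow_nonneg hlog0 _), Real.norm_of_nonneg (Real.rpow_nonneg (by linarith) _),
    Real.rpow_natCast, ← Real.sqrt_eq_rpow] at hX
  -- elementary bounds
  have hfl : (⌊Real.log X / d⌋₊ : ℝ) ≤ Real.log X / d := Nat.floor_le (div_nonneg hlog0 hd.le)
  have h1 : (⌊Real.log X / d⌋₊ : ℝ) + 1 ≤ (1 / d + 1) * Real.log X := by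
    rw [add_mul, one_div, inv_mul_eq_div]; linarith
  have h2 : 2 + (S₀ : ℝ) + ((⌊Real.log X / d⌋₊ : ℝ) + 1) ≤ (3 + S₀ + 1 / d) * Real.log X := by
    have hS : (S₀ : ℝ) ≤ S₀ * Real.log X := le_mul_of_one_le_right (Nat.cast_nonneg _) hlog1
    rw [add_mul, add_mul, one_div, inv_mul_eq_div]; linarith
  have h3 : (Real.log X) ^ κ ≤ Real.log X := by
    interval_cases κ
    · simpa using hlog1
    · simp
  have hsq : 0 ≤ Real.sqrt X := Real.sqrt_nonneg X
  calc 2 * C * ((⌊Real.log X / d⌋₊ : ℝ) + 1) * (2 + S₀ + ((⌊Real.log X / d⌋₊ : ℝ) + 1)) ^ n *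
        Real.sqrt X * (Real.log X) ^ κ
      ≤ 2 * C * ((1 / d + 1) * Real.log X) * ((3 + S₀ + 1 / d) * Real.log X) ^ n * Real.sqrt X * Real.log X := by
        gcongr
    _ = M * (Real.log X) ^ (n + 2) * Real.sqrt X := by rw [hM, mul_pow]; ring
    _ ≤ M * (θ / (M + 1) * Real.sqrt X) * Real.sqrt X := by gcongr
    _ = (M / (M + 1)) * θ * (Real.sqrt X * Real.sqrt X) := by
        have : (M + 1) ≠ 0 := by linarith
        field_simp
    _ ≤ 1 * θ * X := by
        rw [Real.mul_self_sqrt (by linarith)]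
        gcongr
        rw [div_le_one (by linarith)]; linarith
    _ = θ * X := by ring

omit [MeasurableSpace E] [BorelSpace E] in
/-- **The tail `s ≥ S₀` of the box count.** With `F_{sT} ≤ C_F (1+s)^n` and the a priori count
`N(x) ≤ 2cx/(log x)^κ` (`κ ≤ 1`), for every `θ > 0` and all large `X`,
`∑_{m ≤ e^{-dS₀} X} ∑_i F_{s(m) T}(y_i) ≤ c (4 C_F ∑_k (2+S₀+k)^n e^{-d(S₀+k)} + θ) X/(log X)^κ`
(`e`-adic blocks in `s`; blocks below `√X` are absorbed by `θ`). [cite: Mitsui1956, §3] -/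
theorem tail_le {T : Set E} (hT : Convex ℝ T) (h0 : (0 : E) ∈ T) {R : ℝ} (hR : T ⊆ closedBall 0 R)
    {C_F : ℝ} (hC : 0 ≤ C_F)
    (hF : ∀ s : ℝ, 0 ≤ s → ∀ y : E, shapeFun (L := L) (s • T) y ≤ C_F * (1 + s) ^ finrank ℝ E)
    {d : ℝ} (hd : 0 < d) (S₀ : ℕ) {ι : Type u} {S : ℕ → Finset ι} (y : ι → E) {κ : ℕ} (hκ : κ ≤ 1)
    {c : ℝ} (hc : 0 < c)
    (hN : ∀ᶠ x : ℝ in atTop, (∑ m ∈ Icc 1 ⌊x⌋₊, ((S m).card : ℝ)) ≤ 2 * c * x / (Real.log x) ^ κ)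
    {θ : ℝ} (hθ : 0 < θ) :
    ∀ᶠ X : ℝ in atTop,
      ∑ m ∈ Icc 1 ⌊Real.exp (-(d * S₀)) * X⌋₊, ∑ i ∈ S m, shapeFun (L := L) ((Real.log (X / m) / d) • T) (y i) ≤
        c * (4 * C_F * (∑' k : ℕ, (2 + S₀ + (k : ℝ)) ^ finrank ℝ E * Real.exp (-(d * (S₀ + k)))) + θ) *
          X / (Real.log X) ^ κ := by
  set n : ℕ := finrank ℝ E with hn
  -- the summable majorant of the high blocks
  set a : ℕ → ℝ := fun k ↦ (2 + S₀ + (k : ℝ)) ^ n * Real.exp (-(d * (S₀ + k))) with ha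
  have ha0 : ∀ k, 0 ≤ a k := fun k ↦ by positivity
  have hasum : Summable a := by
    have h := (summable_nat_add_iff (S₀ + 2)).2 (Real.summable_pow_mul_exp_neg_nat_mul n hd)
    have heq : a = fun k ↦ Real.exp (2 * d) * ((((k + (S₀ + 2) : ℕ) : ℝ)) ^ n * Real.exp (-d * ((k + (S₀ + 2) : ℕ) : ℝ))) := by
      funext k
      simp only [ha]
      have : ((k + (S₀ + 2) : ℕ) : ℝ) = 2 + S₀ + k := by push_cast; ring
      rw [this, mul_left_comm, ← Real.exp_add]
      congr 1; ring_nf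
    rw [heq]
    exact h.mul_left _
  -- thresholds
  obtain ⟨x₀, hx₀⟩ := eventually_atTop.1 hN
  have hpoly := eventually_polylog_sqrt_le hC hd S₀ n κ hκ hθ
  filter_upwards [hpoly, eventually_ge_atTop (max (x₀ ^ 2) (Real.exp 2)), eventually_ge_atTop (max x₀ 1)]
    with X hXpoly hX2 hX1
  have hXx0sq : x₀ ^ 2 ≤ X := (le_max_left _ _).trans hX2
  have hXe2 : Real.exp 2 ≤ X := (le_max_right _ _).trans hX2
  have hXx0 : x₀ ≤ X := (le_max_left _ _).trans hX1
  have hX1' : 1 ≤ X := (le_max_right _ _).trans hX1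
  have hX0 : 0 < X := by linarith
  have hlogX2 : 2 ≤ Real.log X := by rw [Real.le_log_iff_exp_le hX0]; exact hXe2
  have hlogX0 : 0 < Real.log X := by linarith
  have hsqrt_ge : x₀ ≤ Real.sqrt X := by
    by_cases hx : 0 ≤ x₀
    · exact (Real.le_sqrt hx hX0.le).2 hXx0sq
    · exact (not_le.1 hx).le.trans (Real.sqrt_nonneg _)
  have hsqrt_pos : 0 < Real.sqrt X := Real.sqrt_pos.2 hX0
  have hlog_sqrt : Real.log (Real.sqrt X) = Real.log X / 2 := by
    rw [Real.sqrt_eq_rpow, Real.log_rpow hX0]; ring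
  -- the e-adic blocks
  set u : ℕ → ℝ := fun k ↦ Real.exp (-(d * (S₀ + k))) * X with hu
  have hu_anti : Antitone u := by
    intro i j hij
    simp only [hu]
    refine mul_le_mul_of_nonneg_right (Real.exp_le_exp.2 ?_) hX0.le
    have : (i : ℝ) ≤ j := by exact_mod_cast hij
    nlinarith
  have hu0 : u 0 = Real.exp (-(d * S₀)) * X := by simp [hu]
  set K : ℕ := ⌊Real.log X / d⌋₊ + 1 with hK
  have hKgt : Real.log X / d < K := by rw [hK]; push_cast; exact Nat.lt_floor_add_one _
  have huK : ⌊u K⌋₊ = 0 := by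
    rw [Nat.floor_eq_zero, hu]
    have h1 : Real.exp (-(d * (S₀ + K))) * X ≤ Real.exp (-(d * K)) * X := by
      refine mul_le_mul_of_nonneg_right (Real.exp_le_exp.2 ?_) hX0.le
      have : (0 : ℝ) ≤ d * S₀ := by positivity
      nlinarith
    have h2 : Real.exp (-(d * K)) * X < 1 := by
      rw [Real.exp_neg, inv_mul_lt_iff₀ (Real.exp_pos _), mul_one, ← Real.log_lt_iff_lt_exp hX0]
      rwa [div_lt_iff₀ hd, mul_comm] at hKgt
    exact h1.trans_lt h2
  -- Step 1: telescope
  set Φm : ℕ → ℝ := fun m ↦ ∑ i ∈ S m, shapeFun (L := L) ((Real.log (X / m) / d) • T) (y i) with hΦm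
  have htel := sum_Icc_telescope Φm hu_anti K
  rw [hu0, huK] at htel
  simp only [show Icc 1 0 = (∅ : Finset ℕ) by rfl, Finset.sum_empty, add_zero] at htel
  rw [htel]
  -- Step 2: each block
  have hblock : ∀ k ∈ Finset.range K, ∑ m ∈ Icc 1 ⌊u k⌋₊ \ Icc 1 ⌊u (k + 1)⌋₊, Φm m ≤
      C_F * (2 + S₀ + (k : ℝ)) ^ n * (4 * c * X * Real.exp (-(d * (S₀ + k))) / (Real.log X) ^ κ + 2 * c * Real.sqrt X) := by
    intro k _
    -- bound for the shape function on the block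
    have hterm : ∀ m ∈ Icc 1 ⌊u k⌋₊ \ Icc 1 ⌊u (k + 1)⌋₊, Φm m ≤ C_F * (2 + S₀ + (k : ℝ)) ^ n * (S m).card := by
      intro m hm
      have hm' := mem_block (t := Real.exp (-(d * (S₀ + k)))) (t' := Real.exp (-(d * (S₀ + (k + 1 : ℕ)))))
        (Real.exp_pos _).le (Real.exp_pos _).le hX0.le hm
      obtain ⟨hlt, hle, hm1⟩ := hm'
      have hs0 : 0 ≤ Real.log (X / m) / d :=
        log_div_nonneg hd hm1 (hle.trans (mul_le_of_le_one_left hX0.le (Real.exp_le_one_iff.2 (by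
          have : (0:ℝ) ≤ d * (S₀ + k) := by positivity
          linarith))))
      have hslt : Real.log (X / m) / d < S₀ + (k + 1 : ℕ) := log_div_lt hd hX0 hm1 (by simpa using hlt)
      simp only [hΦm]
      calc ∑ i ∈ S m, shapeFun (L := L) ((Real.log (X / m) / d) • T) (y i)
          ≤ ∑ i ∈ S m, C_F * (2 + S₀ + (k : ℝ)) ^ n := by
            refine Finset.sum_le_sum fun i _ ↦ ?_
            refine (shapeFun_smul_mono hT h0 hR hs0 hslt.le (y i)).trans ?_
            refine (hF _ (by positivity) (y i)).trans (le_of_eq ?_)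
            push_cast; ring
        _ = C_F * (2 + S₀ + (k : ℝ)) ^ n * (S m).card := by rw [Finset.sum_const, nsmul_eq_mul]; ring
    -- the count on the block
    have hcount : ∑ m ∈ Icc 1 ⌊u k⌋₊ \ Icc 1 ⌊u (k + 1)⌋₊, ((S m).card : ℝ) ≤
        4 * c * X * Real.exp (-(d * (S₀ + k))) / (Real.log X) ^ κ + 2 * c * Real.sqrt X := by
      have hsub : ∑ m ∈ Icc 1 ⌊u k⌋₊ \ Icc 1 ⌊u (k + 1)⌋₊, ((S m).card : ℝ) ≤ ∑ m ∈ Icc 1 ⌊u k⌋₊, ((S m).card : ℝ) :=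
        Finset.sum_le_sum_of_subset_of_nonneg Finset.sdiff_subset fun _ _ _ ↦ Nat.cast_nonneg _
      refine hsub.trans ?_
      have hA : 0 ≤ 4 * c * X * Real.exp (-(d * (S₀ + k))) / (Real.log X) ^ κ := by positivity
      have hB : 0 ≤ 2 * c * Real.sqrt X := by positivity
      rcases le_or_gt (Real.sqrt X) (u k) with huk | huk
      · -- high block: `u k ≥ √X ≥ x₀`
        have hNk := hx₀ (u k) (hsqrt_ge.trans huk)
        have huk0 : 0 < u k := hsqrt_pos.trans_le huk
        have hlogk : Real.log X / 2 ≤ Real.log (u k) := by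
          rw [← hlog_sqrt]; exact Real.log_le_log hsqrt_pos huk
        have hlogk0 : 0 < Real.log (u k) := by linarith
        refine (hNk.trans ?_).trans (le_add_of_nonneg_right hB)
        -- `2c u_k/(log u_k)^κ ≤ 4cX e^{..}/(log X)^κ`
        interval_cases κ
        · simp only [pow_zero, div_one, hu]; nlinarith [Real.exp_pos (-(d * (S₀ + k)))]
        · simp only [pow_one]
          rw [div_le_div_iff₀ hlogk0 hlogX0, hu]
          have he := Real.exp_pos (-(d * (S₀ + k)))
          nlinarith [mul_le_mul_of_nonneg_left hlogk (by positivity : (0:ℝ) ≤ 2 * c * (Real.exp (-(d * (S₀ + ↑k))) * X))]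
      · -- low block: `u k < √X`
        have hNk := (count_mono S huk.le).trans (hx₀ (Real.sqrt X) hsqrt_ge)
        refine (hNk.trans ?_).trans (le_add_of_nonneg_left hA)
        have hls : 1 ≤ Real.log (Real.sqrt X) := by rw [hlog_sqrt]; linarith
        interval_cases κ
        · simp
        · rw [pow_one, div_le_iff₀ (by linarith)]
          nlinarith [hsqrt_pos, hc]
    calc ∑ m ∈ Icc 1 ⌊u k⌋₊ \ Icc 1 ⌊u (k + 1)⌋₊, Φm m
        ≤ ∑ m ∈ Icc 1 ⌊u k⌋₊ \ Icc 1 ⌊u (k + 1)⌋₊, C_F * (2 + S₀ + (k : ℝ)) ^ n * (S m).card := Finset.sum_le_sum hterm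
      _ = C_F * (2 + S₀ + (k : ℝ)) ^ n * ∑ m ∈ Icc 1 ⌊u k⌋₊ \ Icc 1 ⌊u (k + 1)⌋₊, ((S m).card : ℝ) := by
          rw [Finset.mul_sum]
      _ ≤ C_F * (2 + S₀ + (k : ℝ)) ^ n * (4 * c * X * Real.exp (-(d * (S₀ + k))) / (Real.log X) ^ κ + 2 * c * Real.sqrt X) :=
          mul_le_mul_of_nonneg_left hcount (by positivity)
  -- Step 3: sum the blocks
  refine (Finset.sum_le_sum hblock).trans ?_
  have hsplit : ∑ k ∈ Finset.range K, C_F * (2 + S₀ + (k : ℝ)) ^ n *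
      (4 * c * X * Real.exp (-(d * (S₀ + k))) / (Real.log X) ^ κ + 2 * c * Real.sqrt X) =
      4 * c * X / (Real.log X) ^ κ * (C_F * ∑ k ∈ Finset.range K, a k) +
        2 * c * Real.sqrt X * (C_F * ∑ k ∈ Finset.range K, (2 + S₀ + (k : ℝ)) ^ n) := by
    simp only [ha, Finset.mul_sum, ← Finset.sum_add_distrib]
    refine Finset.sum_congr rfl fun k _ ↦ ?_
    ring
  rw [hsplit]
  have hhigh : C_F * ∑ k ∈ Finset.range K, a k ≤ C_F * ∑' k, a k :=
    mul_le_mul_of_nonneg_left (hasum.sum_le_tsum _ fun k _ ↦ ha0 k) hC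
  have hlow : 2 * c * Real.sqrt X * (C_F * ∑ k ∈ Finset.range K, (2 + S₀ + (k : ℝ)) ^ n) ≤ c * θ * X / (Real.log X) ^ κ := by
    have hsumK : ∑ k ∈ Finset.range K, (2 + S₀ + (k : ℝ)) ^ n ≤ K * (2 + S₀ + (K : ℝ)) ^ n := by
      calc ∑ k ∈ Finset.range K, (2 + S₀ + (k : ℝ)) ^ n ≤ ∑ k ∈ Finset.range K, (2 + S₀ + (K : ℝ)) ^ n := by
            refine Finset.sum_le_sum fun k hk ↦ pow_le_pow_left₀ (by positivity) ?_ _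
            have : (k : ℝ) ≤ K := by exact_mod_cast (Finset.mem_range.1 hk).le
            linarith
        _ = K * (2 + S₀ + (K : ℝ)) ^ n := by rw [Finset.sum_const, Finset.card_range, nsmul_eq_mul]
    have hKe : (K : ℝ) = (⌊Real.log X / d⌋₊ : ℝ) + 1 := by rw [hK]; push_cast; ring
    rw [le_div_iff₀ (pow_pos hlogX0 _)]
    calc 2 * c * Real.sqrt X * (C_F * ∑ k ∈ Finset.range K, (2 + S₀ + (k : ℝ)) ^ n) * (Real.log X) ^ κ
        ≤ 2 * c * Real.sqrt X * (C_F * (K * (2 + S₀ + (K : ℝ)) ^ n)) * (Real.log X) ^ κ := by gcongr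
      _ = c * (2 * C_F * ((⌊Real.log X / d⌋₊ : ℝ) + 1) * (2 + S₀ + ((⌊Real.log X / d⌋₊ : ℝ) + 1)) ^ n *
            Real.sqrt X * (Real.log X) ^ κ) := by rw [hKe]; ring
      _ ≤ c * (θ * X) := mul_le_mul_of_nonneg_left hXpoly hc.le
      _ = c * θ * X := by ring
  have hXl : 0 ≤ 4 * c * X / (Real.log X) ^ κ := by positivity
  calc 4 * c * X / (Real.log X) ^ κ * (C_F * ∑ k ∈ Finset.range K, a k) +
        2 * c * Real.sqrt X * (C_F * ∑ k ∈ Finset.range K, (2 + S₀ + (k : ℝ)) ^ n)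
      ≤ 4 * c * X / (Real.log X) ^ κ * (C_F * ∑' k, a k) + c * θ * X / (Real.log X) ^ κ :=
        add_le_add (mul_le_mul_of_nonneg_left hhigh hXl) hlow
    _ = c * (4 * C_F * (∑' k, a k) + θ) * X / (Real.log X) ^ κ := by ring

end Blocks

/-! ## The sandwich -/

section Main

variable {L μ}

omit [NormedSpace ℝ E] [FiniteDimensional ℝ E] [MeasurableSpace E] [BorelSpace E] in
/-- A function between `0` and an indicator vanishes off the set. [folklore] -/
theorem eq_zero_of_le_indicator {S : Set E} {h : E → ℝ} (h0 : ∀ x, 0 ≤ h x)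
    (h1 : ∀ x, h x ≤ S.indicator (fun _ ↦ (1 : ℝ)) x) {R : ℝ} (hS : S ⊆ closedBall 0 R) (x : E) (hx : R < ‖x‖) :
    h x = 0 :=
  le_antisymm ((h1 x).trans (le_of_eq (indicator_eq_zero_of_norm hS x hx))) (h0 x)

omit [NormedSpace ℝ E] [FiniteDimensional ℝ E] [MeasurableSpace E] [BorelSpace E] in
/-- A function vanishing off the `1`-thickening of a set in `B(0,R)` vanishes off `B(0, R+2)`. [folklore] -/
theorem eq_zero_of_cthickening {S : Set E} {h : E → ℝ} (h1 : ∀ x, x ∉ cthickening 1 S → h x = 0) {R : ℝ}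
    (hS : S ⊆ closedBall 0 R) (x : E) (hx : R + 2 < ‖x‖) : h x = 0 := by
  refine h1 x fun hmem ↦ ?_
  have h2 := cthickening_subset_thickening' (zero_lt_two) (one_lt_two) S hmem
  obtain ⟨z, hz, hdist⟩ := mem_thickening_iff.1 h2
  have hzR := hS hz
  rw [mem_closedBall, dist_zero_right] at hzR
  rw [dist_eq_norm] at hdist
  have := norm_le_norm_add_norm_sub' x z
  have := norm_sub_rev x z
  linarith [norm_add_le (x - z) z, show x = (x - z) + z by abel]

variable (L μ) in
set_option maxHeartbeats 400000 in
/-- **The sandwich theorem (Mitsui's summation lemma for cube boxes).** For every `ε > 0` there are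
`lo ≤ hi` with `hi − lo ≤ ε`, depending only on `(L, T, d, ε)`, such that for EVERY equidistributed
family with normalisation `x/(log x)^κ`, `κ ≤ 1`, and density `c > 0`, the box count satisfies
`lo ≤ Φ(X) (log X)^κ/(cX) ≤ hi` for all large `X`. [cite: Mitsui1956, §3] -/
theorem exists_sandwich {T : Set E} (hT : Convex ℝ T) (hTc : IsCompact T) (h0 : (0 : E) ∈ T)
    {d : ℝ} (hd : 0 < d) {ε : ℝ} (hε : 0 < ε) :
    ∃ lo hi : ℝ, hi - lo ≤ ε ∧
      ∀ {ι : Type u} (S : ℕ → Finset ι) (y : ι → E) (κ : ℕ) (c : ℝ), κ ≤ 1 → 0 < c →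
        Equidistributed L μ S y κ c →
        ∀ᶠ X : ℝ in atTop, lo ≤ boxCount L T d S y X * ((Real.log X) ^ κ / (c * X)) ∧
          boxCount L T d S y X * ((Real.log X) ^ κ / (c * X)) ≤ hi := by
  set n : ℕ := finrank ℝ E with hn
  -- a radius for `T`
  obtain ⟨R₀, hR₀⟩ := hTc.isBounded.subset_closedBall 0
  set R : ℝ := max R₀ 0 with hRdef
  have hR : T ⊆ closedBall 0 R := hR₀.trans (closedBall_subset_closedBall (le_max_left _ _))
  have hR0 : 0 ≤ R := le_max_right _ _
  -- the uniform bound for the shape function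
  obtain ⟨C_F, hC0, hF⟩ := exists_shapeFun_le (L := L) μ hR hR0
  -- the volume of a period and the volumes of the dilates
  set V : ℝ := μ.real (fdom L) with hV
  have hV0 : 0 < V := measureReal_fdom_pos L μ
  set vT : ℝ := μ.real T with hvT
  have hvT0 : 0 ≤ vT := measureReal_nonneg
  have hw : ∀ s : ℝ, 0 ≤ s → μ.real (s • T) = s ^ n * vT := fun s hs ↦ by
    rw [measureReal_def, Measure.addHaar_smul_of_nonneg μ hs, ENNReal.toReal_mul,
      ENNReal.toReal_ofReal (pow_nonneg hs _), hvT, measureReal_def]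
  -- the small parameter
  set η : ℝ := ε / 8 with hη
  have hη0 : 0 < η := by positivity
  -- the tail parameter `S₀`
  set b : ℕ → ℝ := fun j ↦ (2 + (j : ℝ)) ^ n * Real.exp (-(d * j)) with hb
  have hbtail : Tendsto (fun i : ℕ ↦ ∑' k, b (k + i)) atTop (𝓝 0) := tendsto_sum_nat_add b
  obtain ⟨S₀, hS₀⟩ : ∃ S₀ : ℕ, ∑' k, b (k + S₀) < η / (4 * C_F + 1) := by
    have hpos : 0 < η / (4 * C_F + 1) := div_pos hη0 (by linarith)
    obtain ⟨N, hN⟩ := eventually_atTop.1 ((tendsto_order.1 hbtail).2 _ hpos)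
    exact ⟨N, hN N le_rfl⟩
  have hbS₀ : (∑' k : ℕ, (2 + S₀ + (k : ℝ)) ^ n * Real.exp (-(d * (S₀ + k)))) = ∑' k, b (k + S₀) := by
    refine tsum_congr fun k ↦ ?_
    simp only [hb]; push_cast; ring_nf
  -- the mesh: uniform continuity of `s ↦ s^n vT / V` on `[0, S₀]`
  have huc : ∃ δ₀ : ℝ, 0 < δ₀ ∧ ∀ s ∈ Set.Icc (0 : ℝ) S₀, ∀ s' ∈ Set.Icc (0 : ℝ) S₀, |s - s'| ≤ δ₀ →
      |s ^ n * vT / V - s' ^ n * vT / V| ≤ η := by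
    have hcont : ContinuousOn (fun s : ℝ ↦ s ^ n * vT / V) (Set.Icc 0 S₀) := by fun_prop
    have h := Metric.uniformContinuousOn_iff.1 (isCompact_Icc.uniformContinuousOn_of_continuous hcont) η hη0
    obtain ⟨δ, hδ, hδ'⟩ := h
    refine ⟨δ / 2, half_pos hδ, fun s hs s' hs' hss' ↦ ?_⟩
    have := hδ' s hs s' hs' (by rw [Real.dist_eq]; linarith)
    rw [Real.dist_eq] at this
    exact this.le
  obtain ⟨δ₀, hδ₀, hδ₀'⟩ := huc
  set J : ℕ := ⌈(S₀ : ℝ) / δ₀⌉₊ + 1 with hJ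
  have hJ0 : (0 : ℝ) < J := by rw [hJ]; positivity
  have hmesh : (S₀ : ℝ) / J ≤ δ₀ := by
    rw [div_le_iff₀ hJ0, hJ]
    push_cast
    have h1 : (S₀ : ℝ) / δ₀ ≤ ⌈(S₀ : ℝ) / δ₀⌉₊ := Nat.le_ceil _
    rw [div_le_iff₀ hδ₀] at h1
    nlinarith
  -- the partition points
  set sj : ℕ → ℝ := fun j ↦ (S₀ : ℝ) * j / J with hsj
  have hsj0 : ∀ j, 0 ≤ sj j := fun j ↦ by positivity
  have hsj_mono : Monotone sj := fun i j hij ↦ by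
    simp only [hsj]
    exact div_le_div_of_nonneg_right (mul_le_mul_of_nonneg_left (by exact_mod_cast hij) (Nat.cast_nonneg _)) hJ0.le
  have hsj_succ : ∀ j, sj (j + 1) - sj j = S₀ / J := fun j ↦ by simp only [hsj]; push_cast; ring
  have hsj_le : ∀ j, j ≤ J → sj j ≤ S₀ := fun j hj ↦ by
    simp only [hsj]
    rw [div_le_iff₀ hJ0]
    exact mul_le_mul_of_nonneg_left (by exact_mod_cast hj) (Nat.cast_nonneg _)
  have hsjJ : sj J = S₀ := by simp only [hsj]; field_simp
  set tj : ℕ → ℝ := fun j ↦ Real.exp (-(d * sj j)) with htj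
  have htj_pos : ∀ j, 0 < tj j := fun j ↦ Real.exp_pos _
  have htj_anti : Antitone tj := fun i j hij ↦ Real.exp_le_exp.2 (by nlinarith [hsj_mono hij])
  have htj0 : tj 0 = 1 := by simp [htj, hsj]
  -- the dilates are compact convex with null frontier
  have hcpt : ∀ s : ℝ, IsCompact (s • T) := fun s ↦ hTc.smul s
  have hfr : ∀ s : ℝ, μ (frontier (s • T)) = 0 := fun s ↦ Convex.addHaar_frontier μ (hT.smul s)
  -- majorants and minorants
  have hηV : 0 < η * V := mul_pos hη0 hV0
  choose hp hp_cont hp_ge hp_nn hp_le1 hp_van hp_int using fun j : ℕ ↦ exists_majorant μ (hcpt (sj (j + 1))) hηV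
  choose hm hm_cont hm_le hm_nn hm_int using fun j : ℕ ↦ exists_minorant μ (hcpt (sj j)) (hfr (sj j)) hηV
  -- vanishing radii
  have hp_zero : ∀ j (x : E), sj (j + 1) * R + 2 < ‖x‖ → hp j x = 0 := fun j x hx ↦
    eq_zero_of_cthickening (hp_van j) (smul_subset_closedBall hR (hsj0 _)) x hx
  have hm_zero : ∀ j (x : E), sj j * R < ‖x‖ → hm j x = 0 := fun j x hx ↦
    eq_zero_of_le_indicator (hm_nn j) (hm_le j) (smul_subset_closedBall hR (hsj0 _)) x hx
  -- the bounds
  set w : ℝ → ℝ := fun s ↦ s ^ n * vT / V with hwdef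
  set lo : ℝ := (∑ j ∈ Finset.range J, (tj j - tj (j + 1)) * (w (sj j) - η)) - η with hlo
  set hi : ℝ := (∑ j ∈ Finset.range J, (tj j - tj (j + 1)) * (w (sj (j + 1)) + η)) + η + 2 * η with hhi
  have htsum : ∑ j ∈ Finset.range J, (tj j - tj (j + 1)) = 1 - tj J := by
    rw [Finset.sum_range_sub', htj0]
  have htdiff : ∀ j, 0 ≤ tj j - tj (j + 1) := fun j ↦ sub_nonneg.2 (htj_anti j.le_succ)
  refine ⟨lo, hi, ?_, ?_⟩
  · -- `hi - lo ≤ ε`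
    have hwdiff : ∀ j ∈ Finset.range J, w (sj (j + 1)) - w (sj j) ≤ η := by
      intro j hj
      have hj' := Finset.mem_range.1 hj
      have h := hδ₀' (sj (j + 1)) ⟨hsj0 _, hsj_le _ hj'⟩ (sj j) ⟨hsj0 _, hsj_le _ hj'.le⟩
        (by rw [hsj_succ, abs_of_nonneg (by positivity)]; exact hmesh)
      exact (le_abs_self _).trans h
    have hcalc : hi - lo = (∑ j ∈ Finset.range J, (tj j - tj (j + 1)) * (w (sj (j + 1)) - w (sj j) + 2 * η)) + 4 * η := by
      simp only [hhi, hlo]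
      have : ∀ j ∈ Finset.range J, (tj j - tj (j + 1)) * (w (sj (j + 1)) + η) - (tj j - tj (j + 1)) * (w (sj j) - η) =
          (tj j - tj (j + 1)) * (w (sj (j + 1)) - w (sj j) + 2 * η) := fun j _ ↦ by ring
      rw [← Finset.sum_congr rfl this, Finset.sum_sub_distrib]
      ring
    rw [hcalc]
    have hle : ∑ j ∈ Finset.range J, (tj j - tj (j + 1)) * (w (sj (j + 1)) - w (sj j) + 2 * η) ≤
        ∑ j ∈ Finset.range J, (tj j - tj (j + 1)) * (3 * η) :=
      Finset.sum_le_sum fun j hj ↦ mul_le_mul_of_nonneg_left (by linarith only [hwdiff j hj]) (htdiff j)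
    rw [← Finset.sum_mul, htsum] at hle
    have htJ : 0 < tj J := htj_pos J
    nlinarith only [hle, htJ, hη0, hη, hε]
  · -- the families
    intro ι S y κ c hκ hc hE
    -- the periodizations
    set gp : ℕ → E → ℝ := fun j ↦ periodize L (hp j) with hgp
    set gm : ℕ → E → ℝ := fun j ↦ periodize L (hm j) with hgm
    have hgp_cont : ∀ j, Continuous (gp j) := fun j ↦ continuous_periodize (hp_cont j) (hp_zero j)
    have hgm_cont : ∀ j, Continuous (gm j) := fun j ↦ continuous_periodize (hm_cont j) (hm_zero j)
    have hgp_per : ∀ j, ∀ ℓ ∈ L, ∀ x, gp j (x + ℓ) = gp j x := fun j ℓ hℓ x ↦ periodize_add_of_mem _ hℓ x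
    have hgm_per : ∀ j, ∀ ℓ ∈ L, ∀ x, gm j (x + ℓ) = gm j x := fun j ℓ hℓ x ↦ periodize_add_of_mem _ hℓ x
    -- sandwich of the shape functions
    have hgm_le : ∀ j (x : E), gm j x ≤ shapeFun (L := L) (sj j • T) x := fun j x ↦
      periodize_mono (hm_zero j) (indicator_eq_zero_of_norm (smul_subset_closedBall hR (hsj0 _))) (hm_le j) x
    have hgp_ge : ∀ j (x : E), shapeFun (L := L) (sj (j + 1) • T) x ≤ gp j x := fun j x ↦
      periodize_mono (indicator_eq_zero_of_norm (smul_subset_closedBall hR (hsj0 _))) (hp_zero j) (hp_ge j) x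
    -- means
    have hmean_gp : ∀ j, mean L μ (gp j) ≤ w (sj (j + 1)) + η := by
      intro j
      rw [hgp, mean_periodize μ (hp_cont j) (hp_zero j), ← hV, hwdef]
      simp only
      rw [← hw _ (hsj0 _), inv_mul_le_iff₀ hV0]
      have : V * (μ.real (sj (j + 1) • T) / V + η) = μ.real (sj (j + 1) • T) + η * V := by field_simp
      rw [this]; exact hp_int j
    have hmean_gm : ∀ j, w (sj j) - η ≤ mean L μ (gm j) := by
      intro j
      rw [hgm, mean_periodize μ (hm_cont j) (hm_zero j), ← hV, hwdef]
      simp only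
      rw [← hw _ (hsj0 _), le_inv_mul_iff₀ hV0]
      have : V * (μ.real (sj j • T) / V - η) = μ.real (sj j • T) - η * V := by field_simp
      rw [this]; exact hm_int j
    -- block sums
    set Gp : ℕ → ℝ → ℝ := fun j x ↦ ∑ m ∈ Icc 1 ⌊x⌋₊, ∑ i ∈ S m, gp j (y i) with hGp
    set Gm : ℕ → ℝ → ℝ := fun j x ↦ ∑ m ∈ Icc 1 ⌊x⌋₊, ∑ i ∈ S m, gm j (y i) with hGm
    have hAp : Tendsto (fun X : ℝ ↦ ∑ j ∈ Finset.range J, (Gp j (tj j * X) - Gp j (tj (j + 1) * X)) *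
        ((Real.log X) ^ κ / X)) atTop
        (𝓝 (∑ j ∈ Finset.range J, (tj j - tj (j + 1)) * (c * mean L μ (gp j)))) := by
      refine tendsto_finsetSum _ fun j _ ↦ ?_
      have h1 := tendsto_blockSum hE (hgp_cont j) (hgp_per j) (htj_pos j)
      have h2 := tendsto_blockSum hE (hgp_cont j) (hgp_per j) (htj_pos (j + 1))
      have := h1.sub h2
      simp only [hGp, sub_mul]
      convert this using 2
    have hAm : Tendsto (fun X : ℝ ↦ ∑ j ∈ Finset.range J, (Gm j (tj j * X) - Gm j (tj (j + 1) * X)) *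
        ((Real.log X) ^ κ / X)) atTop
        (𝓝 (∑ j ∈ Finset.range J, (tj j - tj (j + 1)) * (c * mean L μ (gm j)))) := by
      refine tendsto_finsetSum _ fun j _ ↦ ?_
      have h1 := tendsto_blockSum hE (hgm_cont j) (hgm_per j) (htj_pos j)
      have h2 := tendsto_blockSum hE (hgm_cont j) (hgm_per j) (htj_pos (j + 1))
      have := h1.sub h2
      simp only [hGm, sub_mul]
      convert this using 2
    have hcη : 0 < c * η := mul_pos hc hη0
    have hevp := (Metric.tendsto_nhds.1 hAp) (c * η) hcη
    have hevm := (Metric.tendsto_nhds.1 hAm) (c * η) hcη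
    -- tail
    have hN := eventually_count_le hE hc
    have htail := tail_le hT h0 hR hC0 hF hd S₀ y hκ hc hN hη0
    filter_upwards [hevp, hevm, htail, eventually_gt_atTop (1 : ℝ)] with X hXp hXm hXtail hX1
    have hX0 : 0 < X := by linarith
    have hlog : 0 < Real.log X := Real.log_pos hX1
    have hW : 0 < (Real.log X) ^ κ / (c * X) := by positivity
    have hXl : 0 < X / (Real.log X) ^ κ := by positivity
    -- the decomposition of the box count
    set Φm : ℕ → ℝ := fun m ↦ ∑ i ∈ S m, shapeFun (L := L) ((Real.log (X / m) / d) • T) (y i) with hΦm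
    have hΦm0 : ∀ m, 0 ≤ Φm m := fun m ↦ Finset.sum_nonneg fun i _ ↦ shapeFun_nonneg _ _
    have hxanti : Antitone fun k ↦ tj k * X := fun i j hij ↦ mul_le_mul_of_nonneg_right (htj_anti hij) hX0.le
    have htel := sum_Icc_telescope Φm hxanti J
    simp only [htj0, one_mul] at htel
    have hbox : boxCount L T d S y X = ∑ m ∈ Icc 1 ⌊X⌋₊, Φm m := rfl
    have htJX : tj J * X = Real.exp (-(d * S₀)) * X := by simp only [htj, hsjJ]
    -- blockwise sandwich
    have hblock_lo : ∀ j ∈ Finset.range J,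
        Gm j (tj j * X) - Gm j (tj (j + 1) * X) ≤ ∑ m ∈ Icc 1 ⌊tj j * X⌋₊ \ Icc 1 ⌊tj (j + 1) * X⌋₊, Φm m := by
      intro j _
      have hsub : Icc 1 ⌊tj (j + 1) * X⌋₊ ⊆ Icc 1 ⌊tj j * X⌋₊ := Icc_subset_Icc le_rfl (Nat.floor_mono (hxanti j.le_succ))
      simp only [hGm]
      rw [← Finset.sum_sdiff_eq_sub hsub]
      refine Finset.sum_le_sum fun m hm' ↦ Finset.sum_le_sum fun i _ ↦ ?_
      obtain ⟨hlt, hle, hm1⟩ := mem_block (htj_pos j).le (htj_pos (j + 1)).le hX0.le hm'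
      have hs_ge : sj j ≤ Real.log (X / m) / d := le_log_div hd hm1 hle
      exact (hgm_le j (y i)).trans (shapeFun_smul_mono hT h0 hR (hsj0 j) hs_ge (y i))
    have hblock_hi : ∀ j ∈ Finset.range J,
        ∑ m ∈ Icc 1 ⌊tj j * X⌋₊ \ Icc 1 ⌊tj (j + 1) * X⌋₊, Φm m ≤ Gp j (tj j * X) - Gp j (tj (j + 1) * X) := by
      intro j _
      have hsub : Icc 1 ⌊tj (j + 1) * X⌋₊ ⊆ Icc 1 ⌊tj j * X⌋₊ := Icc_subset_Icc le_rfl (Nat.floor_mono (hxanti j.le_succ))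
      simp only [hGp]
      rw [← Finset.sum_sdiff_eq_sub hsub]
      refine Finset.sum_le_sum fun m hm' ↦ Finset.sum_le_sum fun i _ ↦ ?_
      obtain ⟨hlt, hle, hm1⟩ := mem_block (htj_pos j).le (htj_pos (j + 1)).le hX0.le hm'
      have hs_ge : sj j ≤ Real.log (X / m) / d := le_log_div hd hm1 hle
      have hs_lt : Real.log (X / m) / d < sj (j + 1) := log_div_lt hd hX0 hm1 hlt
      exact (shapeFun_smul_mono hT h0 hR ((hsj0 j).trans hs_ge) hs_lt.le (y i)).trans (hgp_ge j (y i))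
    -- the limits versus `lo`, `hi`
    rw [Real.dist_eq] at hXp hXm
    have hΛm : c * (lo + η) ≤ ∑ j ∈ Finset.range J, (tj j - tj (j + 1)) * (c * mean L μ (gm j)) := by
      simp only [hlo, sub_add_cancel, Finset.mul_sum]
      refine Finset.sum_le_sum fun j _ ↦ ?_
      calc c * ((tj j - tj (j + 1)) * (w (sj j) - η)) = (c * (tj j - tj (j + 1))) * (w (sj j) - η) := by ring
        _ ≤ (c * (tj j - tj (j + 1))) * mean L μ (gm j) :=
          mul_le_mul_of_nonneg_left (hmean_gm j) (mul_nonneg hc.le (htdiff j))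
        _ = (tj j - tj (j + 1)) * (c * mean L μ (gm j)) := by ring
    have hΛp : ∑ j ∈ Finset.range J, (tj j - tj (j + 1)) * (c * mean L μ (gp j)) ≤ c * (hi - η - 2 * η) := by
      simp only [hhi]
      have : (∑ j ∈ Finset.range J, (tj j - tj (j + 1)) * (w (sj (j + 1)) + η)) + η + 2 * η - η - 2 * η =
          ∑ j ∈ Finset.range J, (tj j - tj (j + 1)) * (w (sj (j + 1)) + η) := by ring
      rw [this, Finset.mul_sum]
      refine Finset.sum_le_sum fun j _ ↦ ?_
      calc (tj j - tj (j + 1)) * (c * mean L μ (gp j)) = (c * (tj j - tj (j + 1))) * mean L μ (gp j) := by ring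
        _ ≤ (c * (tj j - tj (j + 1))) * (w (sj (j + 1)) + η) :=
          mul_le_mul_of_nonneg_left (hmean_gp j) (mul_nonneg hc.le (htdiff j))
        _ = c * ((tj j - tj (j + 1)) * (w (sj (j + 1)) + η)) := by ring
    -- assemble
    have hWc : (Real.log X) ^ κ / (c * X) = ((Real.log X) ^ κ / X) / c := by rw [div_div, mul_comm]
    rw [hWc, hbox, htel, htJX]
    set W : ℝ := (Real.log X) ^ κ / X with hWdef
    have hW0 : 0 < W := by positivity
    set Main : ℝ := ∑ j ∈ Finset.range J, ∑ m ∈ Icc 1 ⌊tj j * X⌋₊ \ Icc 1 ⌊tj (j + 1) * X⌋₊, Φm m with hMain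
    set Tail : ℝ := ∑ m ∈ Icc 1 ⌊Real.exp (-(d * S₀)) * X⌋₊, Φm m with hTail
    have hTail0 : 0 ≤ Tail := Finset.sum_nonneg fun m _ ↦ hΦm0 m
    have hAm_le : (∑ j ∈ Finset.range J, (Gm j (tj j * X) - Gm j (tj (j + 1) * X))) * W ≤ Main * W :=
      mul_le_mul_of_nonneg_right (Finset.sum_le_sum hblock_lo) hW0.le
    have hAp_ge : Main * W ≤ (∑ j ∈ Finset.range J, (Gp j (tj j * X) - Gp j (tj (j + 1) * X))) * W :=
      mul_le_mul_of_nonneg_right (Finset.sum_le_sum hblock_hi) hW0.le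
    have hXm' := (abs_lt.1 hXm).1
    have hXp' := (abs_lt.1 hXp).2
    rw [← Finset.sum_mul] at hXm' hXp'
    -- the tail in terms of `W`
    have hTailW : Tail * W ≤ 2 * (c * η) := by
      have hser : 4 * C_F * (∑' k : ℕ, (2 + S₀ + (k : ℝ)) ^ n * Real.exp (-(d * (S₀ + k)))) + η ≤ 2 * η := by
        rw [hbS₀]
        have h1 : 4 * C_F * (∑' k, b (k + S₀)) ≤ 4 * C_F * (η / (4 * C_F + 1)) :=
          mul_le_mul_of_nonneg_left hS₀.le (by positivity)
        have h41 : (0 : ℝ) < 4 * C_F + 1 := by linarith only [hC0]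
        have h2 : 4 * C_F * (η / (4 * C_F + 1)) ≤ η := by
          rw [mul_div_assoc', div_le_iff₀ h41]; nlinarith only [hη0, hC0]
        linarith only [h1, h2]
      have h1 : Tail ≤ c * (2 * η) * X / (Real.log X) ^ κ := by
        refine hXtail.trans ?_
        rw [mul_div_assoc, mul_div_assoc]
        exact mul_le_mul_of_nonneg_right (mul_le_mul_of_nonneg_left hser hc.le) hXl.le
      calc Tail * W ≤ c * (2 * η) * X / (Real.log X) ^ κ * W := mul_le_mul_of_nonneg_right h1 hW0.le
        _ = 2 * (c * η) := by rw [hWdef]; field_simp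
    constructor
    · rw [← mul_div_assoc, le_div_iff₀ hc]
      calc lo * c = c * (lo + η) - c * η := by ring
        _ ≤ (∑ j ∈ Finset.range J, (tj j - tj (j + 1)) * (c * mean L μ (gm j))) - c * η := sub_le_sub_right hΛm _
        _ ≤ (∑ j ∈ Finset.range J, (Gm j (tj j * X) - Gm j (tj (j + 1) * X))) * W := by linarith only [hXm']
        _ ≤ Main * W := hAm_le
        _ ≤ (Main + Tail) * W := by nlinarith only [hTail0, hW0]
    · rw [← mul_div_assoc, div_le_iff₀ hc]
      calc (Main + Tail) * W = Main * W + Tail * W := by ring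
        _ ≤ (∑ j ∈ Finset.range J, (Gp j (tj j * X) - Gp j (tj (j + 1) * X))) * W + 2 * (c * η) :=
            add_le_add hAp_ge hTailW
        _ ≤ (∑ j ∈ Finset.range J, (tj j - tj (j + 1)) * (c * mean L μ (gp j))) + c * η + 2 * (c * η) := by
            linarith only [hXp']
        _ ≤ c * (hi - η - 2 * η) + c * η + 2 * (c * η) := by linarith only [hΛp]
        _ = hi * c := by ring

/-- **Transfer of the limit.** If two families are equidistributed (normalisations `κ, κ' ≤ 1`,
densities `c, c' > 0`) and the normalised box count of the second tends to `A`, then so does that of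
the first: `Φ(X) (log X)^κ/(cX) → A`. [cite: Mitsui1956, §3] -/
theorem tendsto_of_tendsto {T : Set E} (hT : Convex ℝ T) (hTc : IsCompact T) (h0 : (0 : E) ∈ T)
    {d : ℝ} (hd : 0 < d) {ι ι' : Type u} {S : ℕ → Finset ι} {y : ι → E} {κ : ℕ} {c : ℝ}
    {S' : ℕ → Finset ι'} {y' : ι' → E} {κ' : ℕ} {c' : ℝ} (hκ : κ ≤ 1) (hc : 0 < c) (hκ' : κ' ≤ 1) (hc' : 0 < c')
    (hE : Equidistributed L μ S y κ c) (hE' : Equidistributed L μ S' y' κ' c') {A : ℝ}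
    (hA : Tendsto (fun X : ℝ ↦ boxCount L T d S' y' X * ((Real.log X) ^ κ' / (c' * X))) atTop (𝓝 A)) :
    Tendsto (fun X : ℝ ↦ boxCount L T d S y X * ((Real.log X) ^ κ / (c * X))) atTop (𝓝 A) := by
  rw [Metric.tendsto_nhds]
  intro ε hε
  obtain ⟨lo, hi, hgap, hfam⟩ := exists_sandwich (L := L) (μ := μ) hT hTc h0 hd (half_pos hε)
  have h1 := hfam S y κ c hκ hc hE
  have h2 := hfam S' y' κ' c' hκ' hc' hE'
  -- `A ∈ [lo, hi]`
  have hAlo : lo ≤ A :=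
    le_of_tendsto_of_tendsto tendsto_const_nhds hA (h2.mono fun X hX ↦ hX.1)
  have hAhi : A ≤ hi :=
    le_of_tendsto_of_tendsto hA tendsto_const_nhds (h2.mono fun X hX ↦ hX.2)
  filter_upwards [h1] with X hX
  rw [Real.dist_eq, abs_lt]
  constructor <;> linarith [hX.1, hX.2]

end Main

end Literature.Algebra.EuclideanLattices.MitsuiSum

end
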